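import Mathlib.Analysis.Calculus.Deriv.Basic
import Mathlib.Analysis.SpecialFunctions.Pow.Real
import Literature.Probability.LatticeModels.CollarLegModel
import Literature.Probability.LatticeModels.DomainDiscretisation
import Literature.Probability.RandomPlanarGeometry.ConformalRectangle
import HarnessLib

/-!
# Rainbow leg laws: the Coulomb-gas product form of boundary leg-insertion partition functions
# of the closed-collar `Δ = -1/2` height model (`RainbowLegLaw`)

Definition request `defn-RainbowLegLaw` (route `CardyBoundaryCoulombGas` of
`CriticalPhenomena/CardyFormulaZ2`, crux `BoundaryDefectGaussianR` = stmt-CriticalPhenomena-14132),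
building on `CollarLegModel` (`LegInsertionData`, `IsAdmissible`, `Zins`: the Baxter–Kelland–Wu
height form of bond percolation at `p = 1/2` on a finite `V ⊂ ℤ²` with boundary leg insertions
[BaxterKellandWu1976]; [DKLM2026SixVertexGFF, Thm 8] is the full-plane Gaussian limit of that
height function).

The physics prediction being TYPED here (it is not asserted — every scaling statement is a route
item): at `k` marked boundary points `x₁, …, x_k` of a bounded domain `Ω` insert `L_i ≥ 1` "legs"
(level lines of the height function) at the sources and let all `Σ L_i` of them end at one sink;
then, as the mesh `δ → 0`, the normalised partition function `|Z_Ω^δ[ins]| / Z_Ω^δ` behaves like a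
boundary Coulomb-gas correlator
`δ^{Σ_i η_i} · C · ∏_{i<j} |u_i - u_j|^{ε_ij} · ∏_i |φ'(u_i)|^{-η_i}` in a uniformizing chart
`φ : ℍ → Ω`, `φ(u_i) = x_i`, with one-body weights `η_i` and pair exponents `ε_ij` read off an
EXPONENT TABLE. For critical percolation the table is the boundary Kac column at `c = 0`:
an `L`-leg boundary insertion has weight `h_{1,L+1} = L(L-1)/6` (`kacWeight`; the half-plane
`j`-crossing exponent `j(j+1)/6 = kacWeight (j+1)` of [SmirnovWernerMRL2001, Thm 3]; boundary
operators `φ_{1,s}` of [CardyNPB1984], [CardyJPhysA1992]; multi-point boundary functions of `SLE₆`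
[Dubedat2005, §4]), with Coulomb-gas labels `e = L` at a source, `e = 1 - L` at the sink and pair
exponents `e_i e_j / 3` (`kacExponents`).

## Contents

* §1 `ExponentData` (a table `ηsrc, ηsnk : ℕ → ℝ`, `εss, εst : ℕ → ℕ → ℝ`), `RainbowType k` (one
  sink carrying the sum of the sources' legs — neutrality `Σ_i s_i L_i = 0` built in — and at least
  one source, so `2 ≤ k`, `RainbowType.two_le`), the vectors `ExponentData.ηvec`, `.εmat`.
* §2 the lattice side: `JordanDomain.IsRectilinear` (frontier in finitely many axis-parallel
  segments; declared as a dot-notation extension of `RandomPlanarGeometry.JordanDomain`),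
  `domainApprox D δ = Ω̄ ∩ δℤ²` literally (via `meshVertices (closure Ω) δ`; `mem_domainApprox`),
  `meshPos δ v = δv ∈ ℂ`, the realisation `legData τ v : LegInsertionData` of a type at lattice
  points (`sinkLegs_legData`: its sink carries `τ.legs τ.sink` legs; `legs_legData_apply`), and the
  phase-normalised ratio `ratio V ι = ‖Zins V ι‖ / ‖Z V‖`.
* §3 the law: `rhs`, `LawClause ηv εm τ C` (one type, one constant), `RainbowLaw X`
  (`∀ k τ, ∃ C > 0, LawClause …` — ONE constant per type, chosen BEFORE the domain, the chart and
  the realisation), `rainbowLaw_congr`, `kacWeight`, `kacExponents`; the crux of the route is the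
  one-liner `RainbowLaw kacExponents`.

## Design choices (each answers a clause of the crux text / a typing hazard of its Disproof file)

* Domains: `MarkedDomain k` (bounded Jordan domain, `k` marks = the insertion points) with
  `IsRectilinear` frontier; lattice approximation `Ω̄ ∩ δℤ²` as a `CollarDomain = Finset (ℤ × ℤ)`
  (empty junk value for `δ ≤ 0`, never met: the law only uses `δ_n > 0`).
* Charts: the tree's `ConformalEquiv upperHalfPlaneSet Ω` with `MarkedDomain.IsUniformizing φ u`
  (onto `Ω`, FINITE real preimages `u_i` of the marks, monotone or antitone), plus boundary
  derivative moduli `d_i = lim_{z → u_i, z ∈ ℍ} ‖φ'(z)‖ ∈ (0, ∞)` as HYPOTHESES (they exist iff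
  `x_i` is not a corner; at corners the clause is vacuous, as the informal statement intends).
* Realisations: SEQUENCES `δ_n → 0⁺`, `v_n : Fin k → ℤ²` injective, admissible
  (`LegInsertionData.IsAdmissible`: non-corner boundary vertices met by the boundary walk, …) with
  `δ_n v_n(i) → x_i`; the sequential form is "locally uniformly in admissible positions".
* Left side `δ_n^{-Σ_i η_i} · ‖Zins‖ / ‖Z‖` (norms divide out the configuration-independent phase;
  `Z = 2^{|E|}`; division by zero would be the junk value `0`), right side `rhs` with real powers
  `Real.rpow` of positive bases (`u` is injective by `IsUniformizing`, `d_i > 0`).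
* `∃ C` stands BEFORE `∀ Ω ∀ φ ∀ (δ_n, v_n)`: a law with a chart-dependent constant would be empty
  of content (the Möbius covariance is part of the claim).

Not here: no named facts (nothing in this file is claimed to hold; `RainbowLaw kacExponents` and
its structural weakenings are route items); no half-lattice `ℤ × ℕ` clause (`Zins` needs a finite
vertex set).
-/

noncomputable section

open Filter Set Topology
open UpperHalfPlane (upperHalfPlaneSet)

namespace Literature.Probability.LatticeModels

namespace RainbowLegLaw

open CollarLegModel (CollarDomain LegInsertionData Zins)
open Literature.Probability.RandomPlanarGeometry (JordanDomain MarkedDomain ConformalEquiv)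

/-! ### §1 Exponent tables and rainbow insertion types -/

/-- An **exponent table** for rainbow leg families: the one-body weight `ηsrc L` of an `L`-leg
SOURCE and `ηsnk L` of an `L`-leg SINK, the pair exponent `εss L L'` of two sources and
`εst Lᵢ L` of an `Lᵢ`-leg source and the `L`-leg sink. For percolation these are the Kac data
`kacExponents`; a structural statement may leave them unknown. [folklore] -/
structure ExponentData where
  /-- weight `η(L)` of an `L`-leg source -/
  ηsrc : ℕ → ℝ
  /-- weight of an `L`-leg sink -/
  ηsnk : ℕ → ℝ
  /-- pair exponent of two sources with `L`, `L'` legs -/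
  εss : ℕ → ℕ → ℝ
  /-- pair exponent of an `Lᵢ`-leg source and the `L`-leg sink -/
  εst : ℕ → ℕ → ℝ

/-- A **rainbow insertion type** on `k` boundary points: the index of the unique sink and the leg
numbers; sources carry `≥ 1` legs, the sink carries the SUM of the sources' legs (neutrality
`Σ_i s_i L_i = 0`, written additively as `Σ_i L_i = 2 · L_sink`), and there is at least one source
(so `2 ≤ k`, `RainbowType.two_le`). [folklore] -/
structure RainbowType (k : ℕ) where
  /-- the index of the sink -/
  sink : Fin k
  /-- leg numbers (`legs sink` is the sink's leg number) -/
  legs : Fin k → ℕ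
  /-- sources have at least one leg -/
  legs_pos : ∀ i, i ≠ sink → 1 ≤ legs i
  /-- neutrality: the sink's legs are the sum of the sources' legs -/
  neutral : ∑ i, legs i = 2 * legs sink
  /-- there is at least one source -/
  exists_source : ∃ i, i ≠ sink

namespace RainbowType

variable {k : ℕ} (τ : RainbowType k)

/-- The sources' leg numbers add up to the sink's. [folklore] -/
theorem sum_erase_sink_legs : ∑ i ∈ Finset.univ.erase τ.sink, τ.legs i = τ.legs τ.sink := by
  have h1 := Finset.add_sum_erase Finset.univ τ.legs (Finset.mem_univ τ.sink)
  have h2 := τ.neutral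
  omega

/-- A source has at most as many legs as the sink. [folklore] -/
theorem legs_le_sink (i : Fin k) (hi : i ≠ τ.sink) : τ.legs i ≤ τ.legs τ.sink := by
  have h2 : τ.legs i ≤ ∑ j ∈ Finset.univ.erase τ.sink, τ.legs j :=
    Finset.single_le_sum (f := τ.legs) (fun _ _ => Nat.zero_le _)
      (Finset.mem_erase.2 ⟨hi, Finset.mem_univ i⟩)
  rwa [τ.sum_erase_sink_legs] at h2

/-- The sink has at least one leg. [folklore] -/
theorem one_le_legs_sink : 1 ≤ τ.legs τ.sink := by
  obtain ⟨i, hi⟩ := τ.exists_source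
  exact (τ.legs_pos i hi).trans (τ.legs_le_sink i hi)

/-- Every insertion point carries at least one leg. [folklore] -/
theorem one_le_legs (i : Fin k) : 1 ≤ τ.legs i := by
  by_cases hi : i = τ.sink
  · rw [hi]; exact τ.one_le_legs_sink
  · exact τ.legs_pos i hi

/-- A rainbow type lives on at least two points (a source and the sink). [folklore] -/
theorem two_le (τ : RainbowType k) : 2 ≤ k := by
  obtain ⟨i, hi⟩ := τ.exists_source
  have h := Fin.val_ne_iff.2 hi
  have := i.isLt
  have := τ.sink.isLt
  omega

/-- The **two-point type** `(L; L̄)`: one `L`-leg source (index `0`) and the `L`-leg sink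
(index `1`), `L ≥ 1`. [folklore] -/
def twoPoint (L : ℕ) (hL : 1 ≤ L) : RainbowType 2 where
  sink := 1
  legs := ![L, L]
  legs_pos := by
    intro i _
    fin_cases i <;> simp [hL]
  neutral := by
    simp only [Fin.sum_univ_two, Fin.isValue, Matrix.cons_val_zero, Matrix.cons_val_one]
    ring
  exists_source := ⟨0, by decide⟩

/-- Rainbow types exist (the two-point type `(1; 1̄)`). [folklore] -/
instance : Nonempty (RainbowType 2) := ⟨twoPoint 1 le_rfl⟩

end RainbowType

namespace ExponentData

variable (X : ExponentData) {k : ℕ}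

/-- The one-body exponent vector `η_i` of a type: `ηsnk` at the sink, `ηsrc` at a source, each
evaluated at the point's leg number. [folklore] -/
def ηvec (τ : RainbowType k) (i : Fin k) : ℝ :=
  if i = τ.sink then X.ηsnk (τ.legs i) else X.ηsrc (τ.legs i)

/-- The pair-exponent matrix `ε_ij` of a type: `εst (source legs) (sink legs)` when one of `i, j`
is the sink, `εss` between two sources, and the junk value `0` on the diagonal (never used: the law
only reads `i < j`). [folklore] -/
def εmat (τ : RainbowType k) (i j : Fin k) : ℝ :=
  if i = j then 0
  else if j = τ.sink then X.εst (τ.legs i) (τ.legs j)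
  else if i = τ.sink then X.εst (τ.legs j) (τ.legs i)
  else X.εss (τ.legs i) (τ.legs j)

/-- `η` at the sink. [folklore] -/
@[simp] theorem ηvec_sink (τ : RainbowType k) : X.ηvec τ τ.sink = X.ηsnk (τ.legs τ.sink) := by
  simp [ηvec]

/-- `η` at a source. [folklore] -/
theorem ηvec_of_ne_sink (τ : RainbowType k) {i : Fin k} (hi : i ≠ τ.sink) :
    X.ηvec τ i = X.ηsrc (τ.legs i) := by
  simp [ηvec, hi]

/-- The diagonal of `εmat` is the junk value `0`. [folklore] -/
@[simp] theorem εmat_self (τ : RainbowType k) (i : Fin k) : X.εmat τ i i = 0 := by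
  simp [εmat]

/-- `ε` between a source `i` and the sink. [folklore] -/
theorem εmat_sink_right (τ : RainbowType k) {i : Fin k} (hi : i ≠ τ.sink) :
    X.εmat τ i τ.sink = X.εst (τ.legs i) (τ.legs τ.sink) := by
  simp [εmat, hi]

/-- `ε` between two distinct sources. [folklore] -/
theorem εmat_of_ne_sink (τ : RainbowType k) {i j : Fin k} (hij : i ≠ j) (hi : i ≠ τ.sink)
    (hj : j ≠ τ.sink) : X.εmat τ i j = X.εss (τ.legs i) (τ.legs j) := by
  simp [εmat, hij, hi, hj]

end ExponentData

/-! ### §2 Lattice side: rectilinear domains, `Ω̄ ∩ δℤ²`, realised insertions, `‖Z[ins]‖/‖Z‖` -/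

/-- A Jordan domain is **rectilinear** when its frontier lies in finitely many axis-parallel
(possibly degenerate) segments, i.e. it is an axis-parallel rectilinear polygon (the hypothesis of
the route item `RectilinearCardy`, verbatim). Declared as a dot-notation extension of
`RandomPlanarGeometry.JordanDomain`. [folklore] -/
def _root_.Literature.Probability.RandomPlanarGeometry.JordanDomain.IsRectilinear
    (D : JordanDomain) : Prop :=
  ∃ S : Finset (ℂ × ℂ), (∀ p ∈ S, p.1.re = p.2.re ∨ p.1.im = p.2.im) ∧
    frontier D.carrier ⊆ ⋃ p ∈ S, segment ℝ p.1 p.2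

/-- **`Ω_δ = Ω̄ ∩ δℤ²`**: the sites of `ℤ²` whose mesh point `δv` lies in the CLOSURE of the Jordan
domain, as a finite vertex set (`CollarDomain`; finite by `meshVertices_finite` since `Ω` is
bounded). Junk value `∅` for `δ ≤ 0`. Cf. `meshVertices` (Chelkak–Smirnov 2012, §1.2). [folklore] -/
def domainApprox (D : JordanDomain) (δ : ℝ) : CollarDomain :=
  if h : 0 < δ then CollarDomain.ofSites (meshVertices_finite D.isBounded.closure h).toFinset
  else ∅

/-- The point `δv ∈ ℂ` of the lattice vertex `v ∈ ℤ²` at mesh `δ` (`meshPoint` in the coordinates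
`ℤ × ℤ` of `CollarLegModel`). [folklore] -/
def meshPos (δ : ℝ) (v : ℤ × ℤ) : ℂ := ⟨δ * v.1, δ * v.2⟩

/-- Real part of `meshPos`. [folklore] -/
@[simp] theorem meshPos_re (δ : ℝ) (v : ℤ × ℤ) : (meshPos δ v).re = δ * v.1 := rfl

/-- Imaginary part of `meshPos`. [folklore] -/
@[simp] theorem meshPos_im (δ : ℝ) (v : ℤ × ℤ) : (meshPos δ v).im = δ * v.2 := rfl

/-- `meshPos` is `meshPoint` read in coordinates. [folklore] -/
theorem meshPoint_eq_meshPos (δ : ℝ) (x : Site 2) : meshPoint δ x = meshPos δ (x 0, x 1) :=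
  Complex.ext (by simp) (by simp)

/-- Membership in `Ω_δ`: `v ∈ domainApprox D δ ↔ δv ∈ Ω̄` (for `δ > 0`). [folklore] -/
theorem mem_domainApprox {D : JordanDomain} {δ : ℝ} (hδ : 0 < δ) (v : ℤ × ℤ) :
    v ∈ domainApprox D δ ↔ meshPos δ v ∈ closure D.carrier := by
  simp only [domainApprox, dif_pos hδ, CollarDomain.ofSites, Finset.mem_image,
    Set.Finite.mem_toFinset, mem_meshVertices_iff, meshPoint_eq_meshPos]
  constructor
  · rintro ⟨x, hx, rfl⟩
    exact hx
  · intro hv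
    exact ⟨![v.1, v.2], by simpa using hv, by simp⟩

/-- `Ω_δ` is empty for `δ ≤ 0` (junk value). [folklore] -/
theorem domainApprox_of_nonpos {D : JordanDomain} {δ : ℝ} (hδ : δ ≤ 0) : domainApprox D δ = ∅ := by
  simp [domainApprox, not_lt.2 hδ]

variable {k : ℕ}

/-- The **leg-insertion datum realising the type `τ` at the lattice points `v`**: the sources are
the images of the non-sink indices with their leg numbers (summed over coincident points, which do
not occur for injective `v`), the sink is `v τ.sink`; its leg number `LegInsertionData.sinkLegs`
is then `τ.legs τ.sink` (`sinkLegs_legData`). [folklore] -/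
def legData (τ : RainbowType k) (v : Fin k → ℤ × ℤ) : LegInsertionData where
  source := (Finset.univ.erase τ.sink).image v
  legs x := ∑ i ∈ (Finset.univ.erase τ.sink).filter (fun i => v i = x), τ.legs i
  sink := v τ.sink

/-- The sink of the realisation is `v τ.sink`. [folklore] -/
@[simp] theorem legData_sink (τ : RainbowType k) (v : Fin k → ℤ × ℤ) :
    (legData τ v).sink = v τ.sink := rfl

/-- The realised sink carries exactly the sink's leg number of the type (neutrality is preserved by
the realisation, whether or not `v` is injective). [folklore] -/
theorem sinkLegs_legData (τ : RainbowType k) (v : Fin k → ℤ × ℤ) :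
    (legData τ v).sinkLegs = τ.legs τ.sink := by
  rw [← τ.sum_erase_sink_legs]
  exact Finset.sum_fiberwise_of_maps_to (fun i hi => Finset.mem_image_of_mem v hi) _

/-- For an injective realisation the source `v i` carries exactly `τ.legs i` legs. [folklore] -/
theorem legs_legData_apply (τ : RainbowType k) {v : Fin k → ℤ × ℤ} (hv : Function.Injective v)
    {i : Fin k} (hi : i ≠ τ.sink) : (legData τ v).legs (v i) = τ.legs i := by
  have h : (Finset.univ.erase τ.sink).filter (fun j => v j = v i) = {i} := by
    ext j
    simp only [Finset.mem_filter, Finset.mem_erase, Finset.mem_univ, Finset.mem_singleton]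
    constructor
    · rintro ⟨-, hj⟩
      exact hv hj
    · rintro rfl
      exact ⟨⟨hi, trivial⟩, rfl⟩
  show ∑ j ∈ (Finset.univ.erase τ.sink).filter (fun j => v j = v i), τ.legs j = τ.legs i
  rw [h, Finset.sum_singleton]

/-- **`Z_Ω^δ[ins] / Z_Ω^δ`, phase-normalised**: the norm of the leg-insertion partition function
`Zins V ι` over the norm of the closed-collar partition function of `V` (by the BKW coupling the
latter is the percolation count `2^{|E|}` and the former has a configuration-independent argument,
which the norm divides out — both validated by enumeration in `CollarLegModel`, neither proved in
the tree). Junk value `0` if the denominator vanished. [folklore] -/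
def ratio (V : CollarDomain) (ι : LegInsertionData) : ℝ :=
  ‖Zins V ι‖ / ‖(CollarLegModel.ofDomain V).Z‖

/-- `ratio` is non-negative. [folklore] -/
theorem ratio_nonneg (V : CollarDomain) (ι : LegInsertionData) : 0 ≤ ratio V ι :=
  div_nonneg (norm_nonneg _) (norm_nonneg _)

/-! ### §3 The law, the Kac table -/

/-- The **right-hand side** `C · ∏_{i<j} |u_i - u_j|^{ε_ij} · ∏_i d_i^{-η_i}` of a rainbow law
(`u_i` the real preimages of the marks, `d_i = |φ'(u_i)|`; real powers `Real.rpow`). [folklore] -/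
def rhs (ηv : Fin k → ℝ) (εm : Fin k → Fin k → ℝ) (C : ℝ) (u d : Fin k → ℝ) : ℝ :=
  C * (∏ i, ∏ j, if i < j then |u i - u j| ^ εm i j else 1) * ∏ i, d i ^ (-(ηv i))

/-- **The law for one type `τ` with exponents `(ηv, εm)` and constant `C`.** For every bounded
Jordan domain `Ω` with `k` marked boundary points `x_i` and rectilinear frontier, every
uniformizing chart `φ : ℍ → Ω` with finite real mark preimages `u_i` (`φ(u_i) = x_i`) and boundary
derivative moduli `d_i = lim_{z → u_i, z ∈ ℍ} ‖φ'(z)‖ ∈ (0, ∞)`, every mesh sequence `δ_n > 0`,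
`δ_n → 0`, and every sequence of injective lattice realisations `v_n` of `τ` with
`δ_n v_n(i) → x_i` whose leg-insertion data are admissible on `Ω_{δ_n} = Ω̄ ∩ δ_n ℤ²`:
`δ_n^{-Σ_i η_i} · ‖Z[ins]‖ / ‖Z‖ → C ∏_{i<j} |u_i - u_j|^{ε_ij} ∏_i d_i^{-η_i}`. [folklore] -/
def LawClause (ηv : Fin k → ℝ) (εm : Fin k → Fin k → ℝ) (τ : RainbowType k) (C : ℝ) : Prop :=
  ∀ (D : MarkedDomain k), D.IsRectilinear →
  ∀ (φ : ConformalEquiv upperHalfPlaneSet D.carrier) (u : Fin k → ℝ), D.IsUniformizing φ u →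
  ∀ (d : Fin k → ℝ), (∀ i, 0 < d i) →
    (∀ i, Tendsto (fun z : ℂ => ‖deriv (fun w : ℂ => φ w) z‖)
      (𝓝[upperHalfPlaneSet] ((u i : ℝ) : ℂ)) (𝓝 (d i))) →
  ∀ (δ : ℕ → ℝ) (v : ℕ → Fin k → ℤ × ℤ),
    (∀ n, 0 < δ n) → Tendsto δ atTop (𝓝 0) → (∀ n, Function.Injective (v n)) →
    (∀ i, Tendsto (fun n => meshPos (δ n) (v n i)) atTop (𝓝 (D.pt i))) →
    (∀ n, (legData τ (v n)).IsAdmissible (domainApprox D.toJordanDomain (δ n))) →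
    Tendsto (fun n => (δ n) ^ (-(∑ i, ηv i)) *
        ratio (domainApprox D.toJordanDomain (δ n)) (legData τ (v n)))
      atTop (𝓝 (rhs ηv εm C u d))

/-- **Rainbow law with exponent table `X`**: for every rainbow type `τ` there is ONE constant
`C = C(τ) ∈ (0, ∞)` for which the law holds in all rectilinear marked domains, all uniformizing
charts and all admissible realisations. [folklore] -/
def RainbowLaw (X : ExponentData) : Prop :=
  ∀ (k : ℕ) (τ : RainbowType k), ∃ C : ℝ, 0 < C ∧ LawClause (X.ηvec τ) (X.εmat τ) τ C

/-- A rainbow law only sees the exponent vectors `ηvec`, `εmat` of its table. [folklore] -/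
theorem rainbowLaw_congr {X Y : ExponentData}
    (hη : ∀ (k : ℕ) (τ : RainbowType k), X.ηvec τ = Y.ηvec τ)
    (hε : ∀ (k : ℕ) (τ : RainbowType k), X.εmat τ = Y.εmat τ) (h : RainbowLaw X) :
    RainbowLaw Y := by
  intro k τ
  obtain ⟨C, hC, hcl⟩ := h k τ
  refine ⟨C, hC, ?_⟩
  rw [← hη, ← hε]
  exact hcl

/-- The **boundary Kac weight** `h(e) = e(e-1)/6` at central charge `0`: `h(L) = h_{1,L+1}`
(`= ¼(r²-1)t - ½(rs-1) + ¼(s²-1)t⁻¹` at `t = 3/2`, `r = 1`, `s = L + 1`), the weight of an `L`-leg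
boundary insertion of critical percolation; `h(j+1) = j(j+1)/6` is the half-plane `j`-crossing
exponent (Smirnov–Werner 2001, Thm 3, site percolation on the triangular lattice), and
`h(1 - e) = h(e)`. [folklore] -/
def kacWeight (e : ℝ) : ℝ := e * (e - 1) / 6

/-- One leg is free: `h(1) = 0`. [folklore] -/
@[simp] theorem kacWeight_one : kacWeight 1 = 0 := by simp [kacWeight]

/-- The symmetry `h(1 - e) = h(e)` of the Kac weight (source label `L` and sink label `1 - L` have
the same weight). [folklore] -/
theorem kacWeight_one_sub (e : ℝ) : kacWeight (1 - e) = kacWeight e := by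
  unfold kacWeight; ring

/-- `h(j + 1) = j(j+1)/6`, the half-plane `j`-crossing exponent (Smirnov–Werner 2001, Thm 3).
[folklore] -/
theorem kacWeight_add_one (j : ℝ) : kacWeight (j + 1) = j * (j + 1) / 6 := by
  unfold kacWeight; ring

/-- The **Kac exponent table** of critical percolation: Coulomb-gas labels `e = L` at an `L`-leg
source and `e = 1 - L` at the `L`-leg sink (the sink rule), one-body weights `h(e)` and pair
exponents `e_i e_j / 3`. [folklore] -/
def kacExponents : ExponentData where
  ηsrc L := kacWeight L
  ηsnk L := kacWeight (1 - L)
  εss L L' := (L : ℝ) * L' / 3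
  εst Li L := (Li : ℝ) * (1 - L) / 3

/-- Source weight of the Kac table. [folklore] -/
@[simp] theorem kacExponents_ηsrc (L : ℕ) : kacExponents.ηsrc L = kacWeight L := rfl

/-- Sink weight of the Kac table. [folklore] -/
@[simp] theorem kacExponents_ηsnk (L : ℕ) : kacExponents.ηsnk L = kacWeight (1 - L) := rfl

/-- Source–source pair exponent of the Kac table. [folklore] -/
@[simp] theorem kacExponents_εss (L L' : ℕ) : kacExponents.εss L L' = (L : ℝ) * L' / 3 := rfl

/-- Source–sink pair exponent of the Kac table. [folklore] -/
@[simp] theorem kacExponents_εst (Li L : ℕ) : kacExponents.εst Li L = (Li : ℝ) * (1 - L) / 3 := rfl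

/-- Sink and source weights of the Kac table agree numerically (`h(1-L) = h(L)`). [folklore] -/
theorem kacExponents_ηsnk_eq_ηsrc (L : ℕ) : kacExponents.ηsnk L = kacExponents.ηsrc L := by
  simp [kacWeight_one_sub]

end RainbowLegLaw

end Literature.Probability.LatticeModels
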